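import Summits.QuantumFields.YangMills.Theorems.AllWindowsColdBoxBoxHighLineRestrictionSetCum3Slots
import Summits.QuantumFields.YangMills.Theorems.AllWindowsColdBoxBoxHighLineTiltFourthMomentRecentre

/-!
# U5 ε₂-glue (G3b-2a): the polarised CROSS term of the fourth cumulant — abstract layer (any finite measure, bounded observables)

Free-hands helper of the κ-lineage (ym-line-fcl-p3 g27) for Steps D–E of the NEXT rung U5 (`stub_landauThirdOrder`, LINE-20, ⟨stmt-QuantumFields-24336⟩).
ASSEMBLY-U5 §3 (planner ym-idea-2 g18): `f″(0)/2 = κ₄,₀(c₀, c_T; U, U)/2`; «the CONNECTED cubic-pair term exactly (L3c, LEAD g78 «ConnectedFourPoint»), all other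
pieces of `κ₄,₀` by parity + Hölder».  Since `κ₄,₀(G₁,G₂; U, U)` is QUADRATIC in the tilt slot, splitting `U = A + R` produces a polarised CROSS term
`E[X̃ỸÃR̃] − E[X̃Ỹ]E[ÃR̃] − E[X̃Ã]E[ỸR̃] − E[X̃R̃]E[ỸÃ]`; this file bounds it abstractly (the `μ_{D′}` identities and Gaussian-letter bound are
`…RestrictionSetCum4Slots`):

* `tiltCum4_zero_eq_quad` (tilt-letter irrelevance of `κ₄,₀` at `t = 0`), ★`abs_tiltExp_mul4_le` (`|E_t[XYUV]| ≤ √(√E_tX⁴·√E_tY⁴)·√(√E_tU⁴·√E_tV⁴)`),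
  `sqrt_tiltExp_sq_le` (`√E_t[W²] ≤ √√E_t[W⁴]`), ★★`abs_cross_le`: `|CROSS| ≤ 4·√(√E X̃⁴·√E Ỹ⁴)·√(√E Ã⁴·√E Ṽ⁴)` (tildes `E_t`-centred; re-centre at
  constants with ✓`Tilt.tiltExp_centred_pow_four_le`).

No definitions; standard axioms.  HONEST LABEL: helper-grade glue for U5 prep; U5, ⟨24004⟩, ⟨24336⟩ remain OPEN; route AllWindowsColdBox is DRAFT;
no crux, rung or summit is proved; the Yang–Mills mass gap is NOT proved by this file; no summit is proved by a line.
-/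

set_option autoImplicit false

noncomputable section

open MeasureTheory Set

namespace Summit.QuantumFields.YangMills.Theorems.AllWindowsColdBoxBoxHighLine

namespace GaussRestrict

/-! ## §1 Abstract layer -/

section Abstract

variable {Ω : Type*} [MeasurableSpace Ω] {μ : Measure Ω}

/-- At `t = 0` the fourth cumulant depends on the tilt letter only through its last two slots (expectations in ANY letter `V`). -/
theorem tiltCum4_zero_eq_quad (μ : Measure Ω) (U V X Y : Ω → ℝ) :
    Tilt.tiltCum4 μ U 0 X Y =
      Tilt.tiltExp μ V 0 (fun x => (X x - Tilt.tiltExp μ V 0 X) * (Y x - Tilt.tiltExp μ V 0 Y) * (U x - Tilt.tiltExp μ V 0 U) ^ 2) -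
        Tilt.tiltExp μ V 0 (fun x => (X x - Tilt.tiltExp μ V 0 X) * (Y x - Tilt.tiltExp μ V 0 Y)) *
          Tilt.tiltExp μ V 0 (fun x => (U x - Tilt.tiltExp μ V 0 U) ^ 2) -
        2 * (Tilt.tiltExp μ V 0 (fun x => (X x - Tilt.tiltExp μ V 0 X) * (U x - Tilt.tiltExp μ V 0 U)) *
          Tilt.tiltExp μ V 0 (fun x => (Y x - Tilt.tiltExp μ V 0 Y) * (U x - Tilt.tiltExp μ V 0 U))) := by
  unfold Tilt.tiltCum4
  simp only [tiltExp_zero_tilt_irrel μ U V]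

/-- ★ **`|E_t[XYUV]| ≤ √(√E_tX⁴·√E_tY⁴)·√(√E_tU⁴·√E_tV⁴)`** for bounded measurable `X, Y, U, V` (two Cauchy–Schwarz layers). -/
theorem abs_tiltExp_mul4_le {X Y U V : Ω → ℝ} {BX BY BU BV : ℝ} (hX : Measurable X) (hY : Measurable Y) (hU : Measurable U)
    (hV : Measurable V) (hXb : ∀ x, |X x| ≤ BX) (hYb : ∀ x, |Y x| ≤ BY) (hUb : ∀ x, |U x| ≤ BU) (hVb : ∀ x, |V x| ≤ BV)
    (W : Ω → ℝ) (t : ℝ) :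
    |Tilt.tiltExp μ W t (fun x => X x * Y x * U x * V x)| ≤
      Real.sqrt (Real.sqrt (Tilt.tiltExp μ W t (fun x => X x ^ 4)) * Real.sqrt (Tilt.tiltExp μ W t (fun x => Y x ^ 4))) *
        Real.sqrt (Real.sqrt (Tilt.tiltExp μ W t (fun x => U x ^ 4)) * Real.sqrt (Tilt.tiltExp μ W t (fun x => V x ^ 4))) := by
  have hXY : Measurable fun x => X x * Y x := hX.mul hY
  have hUV : Measurable fun x => U x * V x := hU.mul hV
  have hXYb : ∀ x, |X x * Y x| ≤ BX * BY := fun x => by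
    rw [abs_mul]; exact mul_le_mul (hXb x) (hYb x) (abs_nonneg _) ((abs_nonneg _).trans (hXb x))
  have hUVb : ∀ x, |U x * V x| ≤ BU * BV := fun x => by
    rw [abs_mul]; exact mul_le_mul (hUb x) (hVb x) (abs_nonneg _) ((abs_nonneg _).trans (hUb x))
  have h1 := Tilt.abs_tiltExp_mul_le (μ := μ) hXY hUV hXYb hUVb W t
  have e0 : (fun x => X x * Y x * U x * V x) = fun x => (X x * Y x) * (U x * V x) := by funext x; ring
  rw [e0]
  -- `E_t[(XY)²] ≤ √E_tX⁴ √E_tY⁴` and the same for `UV`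
  have sq_le : ∀ {P Q : Ω → ℝ} {BP BQ : ℝ}, Measurable P → Measurable Q → (∀ x, |P x| ≤ BP) → (∀ x, |Q x| ≤ BQ) →
      Tilt.tiltExp μ W t (fun x => (P x * Q x) ^ 2) ≤ Real.sqrt (Tilt.tiltExp μ W t (fun x => P x ^ 4)) * Real.sqrt (Tilt.tiltExp μ W t (fun x => Q x ^ 4)) := by
    intro P Q BP BQ hP hQ hPb hQb
    have hP2 : Measurable fun x => P x ^ 2 := hP.pow_const 2
    have hQ2 : Measurable fun x => Q x ^ 2 := hQ.pow_const 2
    have hP2b : ∀ x, |P x ^ 2| ≤ BP ^ 2 := fun x => by rw [abs_pow]; exact pow_le_pow_left₀ (abs_nonneg _) (hPb x) 2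
    have hQ2b : ∀ x, |Q x ^ 2| ≤ BQ ^ 2 := fun x => by rw [abs_pow]; exact pow_le_pow_left₀ (abs_nonneg _) (hQb x) 2
    have h2 := Tilt.abs_tiltExp_mul_le (μ := μ) hP2 hQ2 hP2b hQ2b W t
    have e1 : (fun x => (P x * Q x) ^ 2) = fun x => P x ^ 2 * Q x ^ 2 := by funext x; ring
    have e2 : (fun x => (P x ^ 2) ^ 2) = fun x => P x ^ 4 := by funext x; ring
    have e3 : (fun x => (Q x ^ 2) ^ 2) = fun x => Q x ^ 4 := by funext x; ring
    rw [e2, e3] at h2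
    rw [e1]
    exact (le_abs_self _).trans h2
  have hA := sq_le hX hY hXb hYb
  have hB := sq_le hU hV hUb hVb
  calc |Tilt.tiltExp μ W t (fun x => (X x * Y x) * (U x * V x))|
      ≤ Real.sqrt (Tilt.tiltExp μ W t (fun x => (X x * Y x) ^ 2)) * Real.sqrt (Tilt.tiltExp μ W t (fun x => (U x * V x) ^ 2)) := h1
    _ ≤ _ := mul_le_mul (Real.sqrt_le_sqrt hA) (Real.sqrt_le_sqrt hB) (Real.sqrt_nonneg _) (Real.sqrt_nonneg _)

/-- `√E_t[W²] ≤ √(√E_t[W⁴])` (Jensen `(E_tW²)² ≤ E_tW⁴` on the tilted probability measure; `U` bounded measurable). -/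
theorem sqrt_tiltExp_sq_le [IsFiniteMeasure μ] [NeZero μ] {U W : Ω → ℝ} {BU BW : ℝ} (hU : Measurable U) (hW : Measurable W)
    (hUb : ∀ x, |U x| ≤ BU) (hWb : ∀ x, |W x| ≤ BW) (t : ℝ) :
    Real.sqrt (Tilt.tiltExp μ U t (fun x => W x ^ 2)) ≤ Real.sqrt (Real.sqrt (Tilt.tiltExp μ U t (fun x => W x ^ 4))) := by
  refine Real.sqrt_le_sqrt ?_
  have hW2 : Measurable fun x => W x ^ 2 := hW.pow_const 2
  have hW2b : ∀ x, |W x ^ 2| ≤ BW ^ 2 := fun x => by rw [abs_pow]; exact pow_le_pow_left₀ (abs_nonneg _) (hWb x) 2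
  have h := Tilt.tiltExp_sq_le (μ := μ) hU hW2 hUb hW2b t
  have e : (fun x => (W x ^ 2) ^ 2) = fun x => W x ^ 4 := by funext x; ring
  rw [e] at h
  have h0 : 0 ≤ Tilt.tiltExp μ U t (fun x => W x ^ 2) := by
    haveI := Tilt.isProbabilityMeasure_tilted_mul (μ := μ) hU hUb t
    rw [Tilt.tiltExp_eq_integral_tilted]; exact integral_nonneg fun x => sq_nonneg _
  rw [← abs_of_nonneg h0]
  exact Real.abs_le_sqrt h

/-- ★ **The polarised CROSS term is fourth-moment small**: for bounded measurable `X Y A V` and the tilt letter `W` (bounded measurable), with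
`X̃ = X − E_tX` etc.:  `|E_t[X̃ỸÃṼ] − E_t[X̃Ỹ]E_t[ÃṼ] − E_t[X̃Ã]E_t[ỸṼ] − E_t[X̃Ṽ]E_t[ỸÃ]| ≤ 4·√(√E_tX̃⁴·√E_tỸ⁴)·√(√E_tÃ⁴·√E_tṼ⁴)`. -/
theorem abs_cross_le [IsFiniteMeasure μ] [NeZero μ] {W X Y A V : Ω → ℝ} {BW BX BY BA BV : ℝ} (hW : Measurable W) (hX : Measurable X)
    (hY : Measurable Y) (hA : Measurable A) (hV : Measurable V) (hWb : ∀ x, |W x| ≤ BW) (hXb : ∀ x, |X x| ≤ BX) (hYb : ∀ x, |Y x| ≤ BY)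
    (hAb : ∀ x, |A x| ≤ BA) (hVb : ∀ x, |V x| ≤ BV) (t : ℝ) :
    |Tilt.tiltExp μ W t (fun x => (X x - Tilt.tiltExp μ W t X) * (Y x - Tilt.tiltExp μ W t Y) * (A x - Tilt.tiltExp μ W t A) * (V x - Tilt.tiltExp μ W t V)) -
        Tilt.tiltExp μ W t (fun x => (X x - Tilt.tiltExp μ W t X) * (Y x - Tilt.tiltExp μ W t Y)) *
          Tilt.tiltExp μ W t (fun x => (A x - Tilt.tiltExp μ W t A) * (V x - Tilt.tiltExp μ W t V)) -
        Tilt.tiltExp μ W t (fun x => (X x - Tilt.tiltExp μ W t X) * (A x - Tilt.tiltExp μ W t A)) *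
          Tilt.tiltExp μ W t (fun x => (Y x - Tilt.tiltExp μ W t Y) * (V x - Tilt.tiltExp μ W t V)) -
        Tilt.tiltExp μ W t (fun x => (X x - Tilt.tiltExp μ W t X) * (V x - Tilt.tiltExp μ W t V)) *
          Tilt.tiltExp μ W t (fun x => (Y x - Tilt.tiltExp μ W t Y) * (A x - Tilt.tiltExp μ W t A))| ≤
      4 * (Real.sqrt (Real.sqrt (Tilt.tiltExp μ W t (fun x => (X x - Tilt.tiltExp μ W t X) ^ 4)) *
            Real.sqrt (Tilt.tiltExp μ W t (fun x => (Y x - Tilt.tiltExp μ W t Y) ^ 4))) *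
          Real.sqrt (Real.sqrt (Tilt.tiltExp μ W t (fun x => (A x - Tilt.tiltExp μ W t A) ^ 4)) *
            Real.sqrt (Tilt.tiltExp μ W t (fun x => (V x - Tilt.tiltExp μ W t V) ^ 4)))) := by
  -- the centred observables are bounded measurable
  set mX := Tilt.tiltExp μ W t X
  set mY := Tilt.tiltExp μ W t Y
  set mA := Tilt.tiltExp μ W t A
  set mV := Tilt.tiltExp μ W t V
  have cX : Measurable fun x => X x - mX := hX.sub measurable_const
  have cY : Measurable fun x => Y x - mY := hY.sub measurable_const
  have cA : Measurable fun x => A x - mA := hA.sub measurable_const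
  have cV : Measurable fun x => V x - mV := hV.sub measurable_const
  have bX : ∀ x, |X x - mX| ≤ BX + |mX| := fun x => (abs_sub _ _).trans (add_le_add (hXb x) le_rfl)
  have bY : ∀ x, |Y x - mY| ≤ BY + |mY| := fun x => (abs_sub _ _).trans (add_le_add (hYb x) le_rfl)
  have bA : ∀ x, |A x - mA| ≤ BA + |mA| := fun x => (abs_sub _ _).trans (add_le_add (hAb x) le_rfl)
  have bV : ∀ x, |V x - mV| ≤ BV + |mV| := fun x => (abs_sub _ _).trans (add_le_add (hVb x) le_rfl)
  -- the four-product term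
  have h4 := abs_tiltExp_mul4_le (μ := μ) cX cY cA cV bX bY bA bV W t
  -- the pair terms: Cauchy–Schwarz, then `√E W² ≤ √√E W⁴`
  have sX := sqrt_tiltExp_sq_le (μ := μ) hW cX hWb bX t
  have sY := sqrt_tiltExp_sq_le (μ := μ) hW cY hWb bY t
  have sA := sqrt_tiltExp_sq_le (μ := μ) hW cA hWb bA t
  have sV := sqrt_tiltExp_sq_le (μ := μ) hW cV hWb bV t
  have pXY := Tilt.abs_tiltExp_mul_le (μ := μ) cX cY bX bY W t
  have pAV := Tilt.abs_tiltExp_mul_le (μ := μ) cA cV bA bV W t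
  have pXA := Tilt.abs_tiltExp_mul_le (μ := μ) cX cA bX bA W t
  have pYV := Tilt.abs_tiltExp_mul_le (μ := μ) cY cV bY bV W t
  have pXV := Tilt.abs_tiltExp_mul_le (μ := μ) cX cV bX bV W t
  have pYA := Tilt.abs_tiltExp_mul_le (μ := μ) cY cA bY bA W t
  set x4 := Real.sqrt (Real.sqrt (Tilt.tiltExp μ W t (fun x => (X x - mX) ^ 4)))
  set y4 := Real.sqrt (Real.sqrt (Tilt.tiltExp μ W t (fun x => (Y x - mY) ^ 4)))
  set a4 := Real.sqrt (Real.sqrt (Tilt.tiltExp μ W t (fun x => (A x - mA) ^ 4)))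
  set v4 := Real.sqrt (Real.sqrt (Tilt.tiltExp μ W t (fun x => (V x - mV) ^ 4)))
  have hx0 : 0 ≤ x4 := Real.sqrt_nonneg _
  have hy0 : 0 ≤ y4 := Real.sqrt_nonneg _
  have ha0 : 0 ≤ a4 := Real.sqrt_nonneg _
  have hv0 : 0 ≤ v4 := Real.sqrt_nonneg _
  -- rewrite the square roots of products as products of square roots
  have e1 : Real.sqrt (Real.sqrt (Tilt.tiltExp μ W t (fun x => (X x - mX) ^ 4)) * Real.sqrt (Tilt.tiltExp μ W t (fun x => (Y x - mY) ^ 4))) = x4 * y4 :=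
    Real.sqrt_mul (Real.sqrt_nonneg _) _
  have e2 : Real.sqrt (Real.sqrt (Tilt.tiltExp μ W t (fun x => (A x - mA) ^ 4)) * Real.sqrt (Tilt.tiltExp μ W t (fun x => (V x - mV) ^ 4))) = a4 * v4 :=
    Real.sqrt_mul (Real.sqrt_nonneg _) _
  rw [e1, e2] at h4
  rw [e1, e2]
  -- each pair product is ≤ x4*y4*a4*v4
  have nn : ∀ {P : Ω → ℝ}, 0 ≤ Real.sqrt (Tilt.tiltExp μ W t (fun x => P x ^ 2)) := fun {P} => Real.sqrt_nonneg _
  have q1 : |Tilt.tiltExp μ W t (fun x => (X x - mX) * (Y x - mY)) * Tilt.tiltExp μ W t (fun x => (A x - mA) * (V x - mV))| ≤ x4 * y4 * (a4 * v4) := by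
    rw [abs_mul]
    refine mul_le_mul (pXY.trans (mul_le_mul sX sY nn hx0)) (pAV.trans (mul_le_mul sA sV nn ha0)) (abs_nonneg _) (mul_nonneg hx0 hy0)
  have q2 : |Tilt.tiltExp μ W t (fun x => (X x - mX) * (A x - mA)) * Tilt.tiltExp μ W t (fun x => (Y x - mY) * (V x - mV))| ≤ x4 * a4 * (y4 * v4) := by
    rw [abs_mul]
    refine mul_le_mul (pXA.trans (mul_le_mul sX sA nn hx0)) (pYV.trans (mul_le_mul sY sV nn hy0)) (abs_nonneg _) (mul_nonneg hx0 ha0)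
  have q3 : |Tilt.tiltExp μ W t (fun x => (X x - mX) * (V x - mV)) * Tilt.tiltExp μ W t (fun x => (Y x - mY) * (A x - mA))| ≤ x4 * v4 * (y4 * a4) := by
    rw [abs_mul]
    refine mul_le_mul (pXV.trans (mul_le_mul sX sV nn hx0)) (pYA.trans (mul_le_mul sY sA nn hy0)) (abs_nonneg _) (mul_nonneg hx0 hv0)
  have habs : ∀ (p q r s : ℝ), |p - q - r - s| ≤ |p| + |q| + |r| + |s| := fun p q r s => by
    calc |p - q - r - s| ≤ |p - q - r| + |s| := abs_sub _ _
      _ ≤ |p - q| + |r| + |s| := by linarith [abs_sub (p - q) r]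
      _ ≤ |p| + |q| + |r| + |s| := by linarith [abs_sub p q]
  refine (habs _ _ _ _).trans ?_
  nlinarith [h4, q1, q2, q3, mul_nonneg (mul_nonneg hx0 hy0) (mul_nonneg ha0 hv0)]

end Abstract

end GaussRestrict

end Summit.QuantumFields.YangMills.Theorems.AllWindowsColdBoxBoxHighLine

end
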